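/-
Copyright (c) 2026. All rights reserved.
Released under Apache 2.0 license as described in the file LICENSE.
Authors: abc-iut cell — seat abc-iut-w5-d012 (wave 5, gen 5; D-0079 L-F sub-cell F6, row F-1918 `TotallyRamifiedCriterion`,
GO of abc-iut-L6-lead gen 5, §F v1.19ax (1)).
-/
import Mathlib.GroupTheory.Index
import Mathlib.GroupTheory.SpecificGroups.Cyclic
import Mathlib.Data.ZMod.QuotientGroup
import Mathlib.Algebra.BigOperators.Group.Finset.Basic
import Mathlib.Algebra.Order.BigOperators.Group.Finset
import Literature.AnabelianGeometry.AbsoluteAnabelian.AbsTopIChains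
import HarnessLib

/-!
# F-1918 `TotallyRamifiedCriterion` ([IUTchI] Rmk 1.2.2 (i)): the printed EQUIVALENCE, proved at the Galois group of the
# cyclic covering with cusp numbers computed by orbit counting

S. Mochizuki, *Inter-universal Teichmüller Theory I* [Mochizuki2012], §1, Remark 1.2.2 (i), kurims p. 40 (replacing the final
portion of the proof of [AbsAnab] Lemma 1.3.9 [MochizukiAbsAnab2004] p. 19), for an open subgroup `J ⊆ V` of the maximal
pro-`l` quotient of a geometric fundamental group with `V/J` cyclic of order a power of `l` and the corresponding covering
`Z → V`: "`Z → V` is totally ramified [i.e., at some point of `Z`] … is easily verified to be equivalent to the condition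
that the covering `Z → V` admit a factorization `Z → W → V`, where `W → V` is finite étale of degree `l`, and
`r_W < l · r_V`."  abc-iut-L4-t4 typed the right-hand condition as the PARAMETRISED predicate
`FundamentalExtension.TotallyRamifiedCriterion l c V J` (`AbsTopIChains.lean`; FACT-LIST row F-1918, kernel_closedness =
parametrised) over abstract cusp-number data `c : CuspNumberData D`; abc-iut-w5-d053 recorded its kernel status
(`AbsTopIChainsTotallyRamifiedWitness.lean`: universal closure REFUTED `not_forall_totallyRamifiedCriterion`; satisfiable on
degenerate data `exists_totallyRamifiedCriterion`).  A criterion is not a theorem; what the Remark ASSERTS is the equivalence,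
and THIS PROOF-ONLY file (no `def`, nothing of the parents restated) proves that equivalence at the guarded instance where
the cusp numbers are what they are for a Galois covering:

**Model.** Work in the Galois group `Q := V/J` of the cyclic covering `Z → V` (so `V` ↦ `⊤`, `J` ↦ `⊥`; the criterion's
`W.relIndex V = l` is the index in `Q`).  The cusps of `V` form a finite type `X`; the cusp `x` has inertia
(= decomposition) group `I x ≤ Q` in the covering `Z → V`.  For an intermediate covering `Z/H → V` (`H ≤ Q`) the number of
cusps of `Z/H` is, by orbit counting (double cosets `I_x \ Q / H` = cosets of `I_x·H`, `Q` being abelian — here we only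
use the formula as the DEFINITION of the model's cusp numbers), `r(H) = Σ_x [Q : I_x ⊔ H]`; in particular `r(⊤) = #X = r_V`.
"`Z → V` is totally ramified at some cusp" reads `∃ x, I x = ⊤`.

**Results.**
* `FundamentalExtension.totallyRamifiedCriterion_galois_iff_of_uniqueMaximal` — for ANY finite group `Q` possessing a
  subgroup `W₀` of prime index `l` that contains every proper subgroup (equivalently: `W₀` is the unique maximal subgroup;
  every cyclic group of order `l^k`, `k ≥ 1`, is such with `W₀ = Q^l` — proved below in
  `exists_uniqueMaximal_of_isCyclic_card_primePow`; the prime-order case `W₀ = ⊥` separately):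
  `TotallyRamifiedCriterion l ⟨r⟩ ⊤ ⊥ ↔ ∃ x, I x = ⊤` — the printed equivalence: the only degree-`l` subcover is `Z/W₀`,
  and `r(W₀) = l·#{x : I_x ≤ W₀} + #{x : I_x = Q} < l·#X` iff some `I_x = Q`.
* `FundamentalExtension.totallyRamifiedCriterion_galois_iff_of_prime_card` — the CLOSED guarded instance `|Q| = l` prime
  (`W₀ = ⊥`): a cyclic covering of prime degree `l` is totally ramified at some cusp iff `r_Z < l · r_V`.
* `FundamentalExtension.uniqueMaximal_of_prime_card` — the structural hypotheses of the first theorem hold at prime order.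
* (appended, same seat) `FundamentalExtension.exists_uniqueMaximal_of_isCyclic_card_primePow` — the structural hypotheses hold for
  EVERY CYCLIC group of order `l^k`, `k ≥ 1` (`W₀ = ⟨g^l⟩`: index `l`, contains every proper subgroup, unique of index `l`),
  and `FundamentalExtension.totallyRamifiedCriterion_galois_iff_of_isCyclic_card_primePow` — the printed equivalence in print's own
  setting «`V/J` cyclic of order a power of `l`»: criterion ⟺ some cusp is totally ramified.

HONEST FRAMING / SCOPE: a statement about OUR typed predicate at a combinatorial model of the covering's Galois group (cusp
numbers by the orbit-count formula, taken as the model's definition; the identification of that formula with the cusp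
count of an actual covering of curves, and the cyclic-`l`-group structure of `V/J`, are the guard); nothing of [IUTchI] /
[AbsAnab] beyond Rmk 1.2.2 (i)'s elementary equivalence is asserted; FACT-LIST bookkeeping (D-0079 L-F F6): «¬∀ (schema)
+ print-faithful instance form PROVED».  Nothing here bears on the disputed [IUTchIII] Cor. 3.12; typed ≠ proved elsewhere.
-/

namespace Literature.AnabelianGeometry.AbsoluteAnabelian

namespace FundamentalExtension

universe u v

open scoped BigOperators

variable {Q : Type u} [Group Q] [TopologicalSpace Q]

/-- In the criterion at `V = ⊤`, `J = ⊥` the intermediate `W` is any subgroup of index `l`, and the cusp-number condition is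
read on it. [cite: Mochizuki2012, IUTchI Rmk 1.2.2 (i) p.40] -/
theorem totallyRamifiedCriterion_top_bot_iff (l : ℕ) (c : CuspNumberData Q) :
    TotallyRamifiedCriterion l c ⊤ ⊥ ↔ ∃ W : Subgroup Q, W.index = l ∧ c.r W < l * c.r ⊤ := by
  constructor
  · rintro ⟨W, -, -, hidx, hlt⟩
    exact ⟨W, by rwa [Subgroup.relIndex_top_right] at hidx, hlt⟩
  · rintro ⟨W, hidx, hlt⟩
    exact ⟨W, bot_le, le_top, by rwa [Subgroup.relIndex_top_right], hlt⟩

omit [TopologicalSpace Q] in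
/-- Orbit-count cusp numbers: over the TOP subgroup (the covering `V → V` itself) every cusp contributes `1`, so
`r(⊤) = #X = r_V`. [cite: Mochizuki2012, IUTchI Rmk 1.2.2 (i) p.40] -/
theorem sum_index_sup_top {X : Type v} [Fintype X] (I : X → Subgroup Q) :
    (∑ x, (I x ⊔ ⊤).index) = Fintype.card X := by
  simp [Subgroup.index_top]

/-- **[IUTchI] Rmk 1.2.2 (i), the printed equivalence at the Galois group of the cyclic covering (structural form).**  Let the
finite group `Q` (playing `V/J`) have a subgroup `W₀` of PRIME index `l` containing every proper subgroup (the unique maximal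
subgroup — classically the case for every cyclic group of order `l^k`, `k ≥ 1`; proved below at prime order).  For cusps `x : X` of `V` with inertia groups `I x ≤ Q`
and cusp numbers of intermediate coverings given by orbit counting `r(H) = Σ_x [Q : I_x ⊔ H]`:
the amended total-ramification criterion `TotallyRamifiedCriterion l ⟨r⟩ ⊤ ⊥` ("`Z → V` factors through a degree-`l`
cover `W → V` with `r_W < l·r_V`") holds IFF `Z → V` is totally ramified at some cusp (`∃ x, I x = ⊤`).
[cite: Mochizuki2012, IUTchI Rmk 1.2.2 (i) p.40] [cite: MochizukiAbsAnab2004, Lemma 1.3.9 p.19] -/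
theorem totallyRamifiedCriterion_galois_iff_of_uniqueMaximal [Finite Q] {l : ℕ} (hl : l.Prime)
    (W₀ : Subgroup Q) (hW₀ : W₀.index = l) (huniq : ∀ W : Subgroup Q, W.index = l → W = W₀)
    (hmax : ∀ H : Subgroup Q, H ≠ ⊤ → H ≤ W₀)
    {X : Type v} [Fintype X] (I : X → Subgroup Q) :
    TotallyRamifiedCriterion l ⟨fun H => ∑ x, (I x ⊔ H).index⟩ ⊤ ⊥ ↔ ∃ x, I x = ⊤ := by
  classical
  rw [totallyRamifiedCriterion_top_bot_iff]
  -- the value of each summand over `W₀`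
  have hterm : ∀ x, (I x ⊔ W₀).index = if I x = ⊤ then 1 else l := by
    intro x
    by_cases hx : I x = ⊤
    · rw [if_pos hx, hx, top_sup_eq, Subgroup.index_top]
    · rw [if_neg hx, sup_eq_right.mpr (hmax (I x) hx), hW₀]
  have htop : (∑ x, (I x ⊔ ⊤).index) = Fintype.card X := sum_index_sup_top I
  constructor
  · rintro ⟨W, hidx, hlt⟩
    obtain rfl := huniq W hidx
    -- if no inertia group is all of `Q`, every summand over `W₀` equals `l` and the inequality fails
    by_contra hno
    simp only [not_exists] at hno
    have hsum : (∑ x, (I x ⊔ W).index) = l * Fintype.card X := by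
      rw [Finset.sum_congr rfl (fun x _ => (hterm x).trans (if_neg (hno x))), Finset.sum_const, smul_eq_mul,
        Finset.card_univ, mul_comm]
    change (∑ x, (I x ⊔ W).index) < l * ∑ x, (I x ⊔ ⊤).index at hlt
    rw [hsum, htop] at hlt
    exact lt_irrefl _ hlt
  · rintro ⟨x₀, hx₀⟩
    refine ⟨W₀, hW₀, ?_⟩
    change (∑ x, (I x ⊔ W₀).index) < l * ∑ x, (I x ⊔ ⊤).index
    rw [htop]
    -- every summand is `≤ l`, and the one at `x₀` is `1 < l`
    calc (∑ x, (I x ⊔ W₀).index) < ∑ _x : X, l := by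
          apply Finset.sum_lt_sum
          · intro x _
            rw [hterm x]
            split_ifs
            · exact hl.one_lt.le
            · exact le_rfl
          · exact ⟨x₀, Finset.mem_univ _, by rw [hterm x₀, if_pos hx₀]; exact hl.one_lt⟩
      _ = l * Fintype.card X := by rw [Finset.sum_const, smul_eq_mul, Finset.card_univ, mul_comm]

omit [TopologicalSpace Q] in
/-- At PRIME order the structural hypotheses hold with `W₀ := ⊥`: `[Q : 1] = |Q| = l`, a subgroup of index `|Q|` is trivial,
and every proper subgroup of a group of prime order is trivial. [cite: Mochizuki2012, IUTchI Rmk 1.2.2 (i) p.40] -/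
theorem uniqueMaximal_of_prime_card {l : ℕ} (hl : l.Prime) (hQ : Nat.card Q = l) :
    (⊥ : Subgroup Q).index = l ∧ (∀ W : Subgroup Q, W.index = l → W = ⊥) ∧
      ∀ H : Subgroup Q, H ≠ ⊤ → H ≤ ⊥ := by
  haveI : Fact (Nat.card Q).Prime := ⟨hQ.symm ▸ hl⟩
  have hfin : Finite Q := Nat.finite_of_card_ne_zero (hQ.symm ▸ hl.ne_zero)
  refine ⟨by rw [Subgroup.index_bot, hQ], fun W hW => ?_, fun H hH => ?_⟩
  · -- `|W| · [Q : W] = |Q|` with `[Q : W] = |Q|` forces `|W| = 1`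
    have h := W.card_mul_index
    rw [hW, hQ] at h
    have hW1 : Nat.card W = 1 := by
      have hl0 : 0 < l := hl.pos
      nlinarith [h, hl0]
    exact (Subgroup.card_eq_one.mp hW1)
  · rcases H.eq_bot_or_eq_top_of_prime_card with h | h
    · exact h.le
    · exact absurd h hH

/-- **[IUTchI] Rmk 1.2.2 (i), CLOSED guarded instance (cyclic covering of PRIME degree `l`).**  If the Galois group `Q` of
`Z → V` has prime order `l`, then — with cusp numbers by orbit counting — the amended criterion
`TotallyRamifiedCriterion l ⟨r⟩ ⊤ ⊥` (here: `r_Z < l · r_V`, the only degree-`l` subcover being `Z` itself) holds IFF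
`Z → V` is totally ramified at some cusp. [cite: Mochizuki2012, IUTchI Rmk 1.2.2 (i) p.40] -/
theorem totallyRamifiedCriterion_galois_iff_of_prime_card {l : ℕ} (hl : l.Prime) (hQ : Nat.card Q = l)
    {X : Type v} [Fintype X] (I : X → Subgroup Q) :
    TotallyRamifiedCriterion l ⟨fun H => ∑ x, (I x ⊔ H).index⟩ ⊤ ⊥ ↔ ∃ x, I x = ⊤ := by
  have hfin : Finite Q := Nat.finite_of_card_ne_zero (hQ.symm ▸ hl.ne_zero)
  obtain ⟨h1, h2, h3⟩ := uniqueMaximal_of_prime_card (Q := Q) hl hQ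
  exact totallyRamifiedCriterion_galois_iff_of_uniqueMaximal hl ⊥ h1 h2 h3 I

/-- Numerical corollary at prime degree: the cusp count of the model reads `r_Z = l·#{unramified cusps} + #{totally ramified
cusps}`, so `r_Z < l · r_V` iff some cusp is totally ramified — the [AbsAnab] numerology `r_Z = deg(Z/V)·(r_V − 1) + 1` being
the case of exactly one such cusp. Stated as: with NO totally ramified cusp the criterion FAILS, with one it HOLDS.
[cite: MochizukiAbsAnab2004, Lemma 1.3.9 p.19] -/
theorem totallyRamifiedCriterion_galois_of_prime_card_of_inertia_eq_top {l : ℕ} (hl : l.Prime) (hQ : Nat.card Q = l)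
    {X : Type v} [Fintype X] (I : X → Subgroup Q) (x₀ : X) (hx₀ : I x₀ = ⊤) :
    TotallyRamifiedCriterion l ⟨fun H => ∑ x, (I x ⊔ H).index⟩ ⊤ ⊥ :=
  (totallyRamifiedCriterion_galois_iff_of_prime_card hl hQ I).mpr ⟨x₀, hx₀⟩

/-! ### Appended (same seat, same row): the cyclic prime-power case = print's «`V/J` cyclic of order a power of `l`» -/

omit [TopologicalSpace Q] in
/-- In a cyclic group with generator `g` of order `l^k` (`l` prime), a subgroup containing some `g ^ n` with `l ∤ n` is
everything (`g ^ n` is again a generator: `gcd(n, l^k) = 1`). [folklore] -/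
private theorem eq_top_of_pow_mem_of_not_dvd {l k : ℕ} (hl : l.Prime) {g : Q} (hg : ∀ x, x ∈ Subgroup.zpowers g)
    (hord : orderOf g = l ^ k) {n : ℕ} (hn : ¬ l ∣ n) {H : Subgroup Q} (hh : g ^ n ∈ H) : H = ⊤ := by
  have hcop : n.gcd (orderOf g) = 1 := by
    rw [hord]
    exact Nat.Coprime.pow_right k ((Nat.Prime.coprime_iff_not_dvd hl).mpr hn).symm
  have hg' : g ∈ Subgroup.zpowers (g ^ n) := mem_zpowers_pow_iff.mpr hcop
  have hgH : g ∈ H := (Subgroup.zpowers_le.mpr hh) hg'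
  rw [eq_top_iff]
  intro x _
  exact (Subgroup.zpowers_le.mpr hgH) (hg x)

omit [TopologicalSpace Q] in
/-- **Cyclic groups of prime-power order have a unique maximal subgroup, of index `l`.**  For `Q` cyclic with
`|Q| = l^k`, `k ≥ 1`, `l` prime, and a generator `g`: `W₀ := ⟨g^l⟩` has index `l`, every proper subgroup is contained in
it (a proper subgroup contains only `l`-th powers of `g`), and it is the only subgroup of index `l`.  These are exactly the
structural hypotheses of `totallyRamifiedCriterion_galois_iff_of_uniqueMaximal`, in print's setting «`V/J` cyclic of order a
power of `l`». [folklore] [cite: Mochizuki2012, IUTchI Rmk 1.2.2 (i) p.40] -/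
theorem exists_uniqueMaximal_of_isCyclic_card_primePow [Finite Q] [IsCyclic Q] {l k : ℕ} (hl : l.Prime) (hk : 1 ≤ k)
    (hQ : Nat.card Q = l ^ k) :
    ∃ W₀ : Subgroup Q, W₀.index = l ∧ (∀ W : Subgroup Q, W.index = l → W = W₀) ∧
      ∀ H : Subgroup Q, H ≠ ⊤ → H ≤ W₀ := by
  obtain ⟨g, hg⟩ := IsCyclic.exists_generator (α := Q)
  have hord : orderOf g = l ^ k := (orderOf_eq_card_of_forall_mem_zpowers hg).trans hQ
  have hl0 : l ≠ 0 := hl.ne_zero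
  obtain ⟨k', rfl⟩ : ∃ k', k = k' + 1 := ⟨k - 1, by omega⟩
  have hcardW : Nat.card (Subgroup.zpowers (g ^ l)) = l ^ k' := by
    rw [Nat.card_zpowers, orderOf_pow' g hl0, hord]
    have hgcd : Nat.gcd (l ^ (k' + 1)) l = l := Nat.gcd_eq_right (dvd_pow_self l (Nat.succ_ne_zero k'))
    rw [hgcd, pow_succ, Nat.mul_div_cancel _ hl.pos]
  have hidx : (Subgroup.zpowers (g ^ l)).index = l := by
    have h := (Subgroup.zpowers (g ^ l)).card_mul_index
    rw [hcardW, hQ, pow_succ] at h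
    exact Nat.eq_of_mul_eq_mul_left (pow_pos hl.pos k') h
  have hmax : ∀ H : Subgroup Q, H ≠ ⊤ → H ≤ Subgroup.zpowers (g ^ l) := by
    intro H hH h hh
    obtain ⟨m, rfl⟩ := Subgroup.mem_zpowers_iff.mp (hg h)
    -- pass to a natural exponent
    have hn : ∃ n : ℕ, g ^ m = g ^ n := by
      refine ⟨(m % (orderOf g : ℤ)).toNat, ?_⟩
      have hpos : (0 : ℤ) < (orderOf g : ℤ) := by
        have : 0 < orderOf g := by rw [hord]; exact pow_pos hl.pos _
        exact_mod_cast this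
      rw [← zpow_natCast, Int.toNat_of_nonneg (Int.emod_nonneg _ hpos.ne'), zpow_mod_orderOf]
    obtain ⟨n, hn⟩ := hn
    rw [hn] at hh ⊢
    by_cases hdvd : l ∣ n
    · obtain ⟨t, rfl⟩ := hdvd
      rw [pow_mul]
      exact Subgroup.npow_mem_zpowers _ _
    · exact absurd (eq_top_of_pow_mem_of_not_dvd hl hg hord hdvd hh) hH
  refine ⟨Subgroup.zpowers (g ^ l), hidx, fun W hW => ?_, hmax⟩
  have hWne : W ≠ ⊤ := by
    intro h
    rw [h, Subgroup.index_top] at hW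
    exact hl.one_lt.ne' hW.symm
  have hle : W ≤ Subgroup.zpowers (g ^ l) := hmax W hWne
  have hcardWW : Nat.card W = l ^ k' := by
    have h := W.card_mul_index
    rw [hW, hQ, pow_succ] at h
    exact Nat.eq_of_mul_eq_mul_right hl.pos h
  exact Subgroup.eq_of_le_of_card_ge hle (by rw [hcardW, hcardWW])

/-- **[IUTchI] Rmk 1.2.2 (i) in print's setting: `V/J` CYCLIC OF ORDER A POWER OF `l`.**  If the Galois group `Q` of the
cyclic covering `Z → V` is cyclic of order `l^k`, `k ≥ 1` (`l` prime), then — cusp numbers by orbit counting — the amended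
criterion `TotallyRamifiedCriterion l ⟨r⟩ ⊤ ⊥` ("`Z → V` factors through a degree-`l` cover `W → V` with `r_W < l·r_V`";
here `W = Z/⟨g^l⟩`, the unique such) holds IFF `Z → V` is totally ramified at some cusp.
[cite: Mochizuki2012, IUTchI Rmk 1.2.2 (i) p.40] [cite: MochizukiAbsAnab2004, Lemma 1.3.9 p.19] -/
theorem totallyRamifiedCriterion_galois_iff_of_isCyclic_card_primePow [Finite Q] [IsCyclic Q] {l k : ℕ} (hl : l.Prime)
    (hk : 1 ≤ k) (hQ : Nat.card Q = l ^ k) {X : Type v} [Fintype X] (I : X → Subgroup Q) :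
    TotallyRamifiedCriterion l ⟨fun H => ∑ x, (I x ⊔ H).index⟩ ⊤ ⊥ ↔ ∃ x, I x = ⊤ := by
  obtain ⟨W₀, h1, h2, h3⟩ := exists_uniqueMaximal_of_isCyclic_card_primePow (Q := Q) hl hk hQ
  exact totallyRamifiedCriterion_galois_iff_of_uniqueMaximal hl W₀ h1 h2 h3 I

end FundamentalExtension

end Literature.AnabelianGeometry.AbsoluteAnabelian
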